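import Literature.NumberTheory.EllipticCurves.ModularFunctionFieldPlacesOverJ
import Literature.NumberTheory.EllipticCurves.ModularFunctionFieldPointValues
import Mathlib.RingTheory.DedekindDomain.IntegralClosure
import Mathlib.RingTheory.Valuation.LocalSubring
import HarnessLib

/-!
# The ring of modular functions holomorphic on `ℍ`: the integral closure of `ℂ[j]` in `K_N`

Topic `NumberTheory/EllipticCurves` (third file of the "canonical model of `X₀(N)` at CM points"
chain, after `ModularCurveEisensteinCoordinates` and `ModularFunctionFieldPlacesOverJ`).  We make the
modular function field `K_N = ℂ(X₀(N))` (`modularFunctionField N`) an algebra over the polynomial ring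
`ℂ[X]` and the rational function field `ℂ(X)` through `X ↦ j` (`algebraPolyJ`, `algebraRatFunc`; local
instances) and study the integral closure `B = intClosureJ N` of `ℂ[j]` in `K_N` — the affine
coordinate ring of `Y₀(N) = X₀(N) ∖ {cusps}`:

* `finite_intClosureJ`, `isDedekindDomain_intClosureJ` — `B` is a finite `ℂ[j]`-module and a Dedekind
  domain (Mathlib's `IsIntegralClosure.finite` / `integralClosure.isDedekindDomain` over the finite
  separable extension `K_N / ℂ(j)` of degree `μ`, `finrank_ratFuncJ`);
* `mem_intClosureJ_iff` — **`B` is the ring of modular functions holomorphic at every point of `ℍ`**: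
  `x ∈ B ↔ ∀ τ, x ∈ O_{P_τ}` (Krull: the integral closure is the intersection of the valuation rings
  containing `ℂ[j]`, and these are the `O_{P_τ}`, `exists_eq_pointPlace`);
* `exists_polyJ_smul_mem_intClosureJ` — every `h ∈ K_N` is `b / a(j)` with `b ∈ B`, `a ∈ ℂ[X] ∖ 0`;
* `idealAt τ` — the maximal ideal `B ∩ m_{P_τ}` of functions vanishing at `τ`, and
  `exists_eq_idealAt` — **every nonzero prime of `B` is `B ∩ m_{P_τ}` for some `τ ∈ ℍ`** (Chevalley's
  extension theorem `Ideal.image_subset_nonunits_valuationSubring` plus `exists_eq_pointPlace`): the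
  maximal spectrum of `B` is `Y₀(N)` (Shimura 1971, §1.6–1.8 and Prop. 2.11; Diamond–Shurman §7.5);
* `mkFn_deltaN_mem_intClosureJ` — `F/Δ ∈ B` for a weight-`12` form `F` (values at points:
  `ModularFunctionFieldPointValues`).

Everything is proved; no named facts are introduced.

## References

* G. Shimura, *Introduction to the arithmetic theory of automorphic functions*, 1971, §1.6–1.8,
  Prop. 2.11. [ShimuraIATAF1971]
* F. Diamond, J. Shurman, *A First Course in Modular Forms*, GTM 228, 2005, §7.5. [DiamondShurman2005]
* H. Stichtenoth, *Algebraic Function Fields and Codes*, 2nd ed., GTM 254, 2009, Thm. 1.1.6,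
  Cor. 3.3.5. [Stichtenoth2009]
-/

noncomputable section

open scoped MatrixGroups ModularForm Modular Classical IntermediateField WithZero
open CongruenceSubgroup Matrix.SpecialLinearGroup ModularGroup ModularForm EisensteinSeries Polynomial
open UpperHalfPlane hiding I
open Literature.NumberTheory.DiophantineGeometry
open Literature.NumberTheory.DiophantineGeometry.AlgFunctionField

namespace Literature.NumberTheory.EllipticCurves.ModularForms

variable {N : ℕ} [NeZero N]

/-! ### `K_N` as an algebra over `ℂ[X]` and `ℂ(X)` through `X ↦ j` -/

/-- `ℂ[X]` acts on `K_N` through `X ↦ j` (a local instance: `algebraMap = aeval j`). [folklore] -/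
@[reducible] def algebraPolyJ (N : ℕ) : Algebra ℂ[X] (modularFunctionField N) :=
  (Polynomial.aeval (kleinJK N)).toRingHom.toAlgebra

attribute [local instance] algebraPolyJ

omit [NeZero N] in
/-- The structure map `ℂ[X] → K_N` is evaluation at `j`. [folklore] -/
theorem algebraMap_polyJ (p : ℂ[X]) :
    algebraMap ℂ[X] (modularFunctionField N) p = Polynomial.aeval (kleinJK N) p := rfl

omit [NeZero N] in
/-- `X ↦ j`. [folklore] -/
theorem algebraMap_polyJ_X : algebraMap ℂ[X] (modularFunctionField N) X = kleinJK N := by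
  rw [algebraMap_polyJ, aeval_X]

/-- `ℂ → ℂ[X] → K_N` is a scalar tower. [folklore] -/
instance isScalarTower_polyJ : IsScalarTower ℂ ℂ[X] (modularFunctionField N) :=
  IsScalarTower.of_algebraMap_eq fun c ↦ by
    rw [algebraMap_polyJ, Polynomial.algebraMap_apply, aeval_C]; rfl

omit [NeZero N] in
/-- `ℂ[X] → K_N` is injective (`j` is transcendental). [folklore] -/
theorem algebraMap_polyJ_injective :
    Function.Injective (algebraMap ℂ[X] (modularFunctionField N)) :=
  transcendental_iff_injective.mp transcendental_kleinJK

/-- `ℂ(X) → K_N`, `X ↦ j` (Mathlib's `RatFunc.liftAlgHom` of `aeval j`). [folklore] -/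
def ratFuncAlgHom (N : ℕ) [NeZero N] : RatFunc ℂ →ₐ[ℂ] modularFunctionField N :=
  RatFunc.liftAlgHom (Polynomial.aeval (kleinJK N))
    (nonZeroDivisors_le_comap_nonZeroDivisors_of_injective _ (algebraMap_polyJ_injective (N := N)))

/-- `ℂ(X)` acts on `K_N` through `X ↦ j` (a local instance). [folklore] -/
@[reducible] def algebraRatFunc (N : ℕ) [NeZero N] : Algebra (RatFunc ℂ) (modularFunctionField N) :=
  (ratFuncAlgHom N).toRingHom.toAlgebra

attribute [local instance] algebraRatFunc

/-- The structure map `ℂ(X) → K_N` is `ratFuncAlgHom`. [folklore] -/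
theorem algebraMap_ratFunc (x : RatFunc ℂ) :
    algebraMap (RatFunc ℂ) (modularFunctionField N) x = ratFuncAlgHom N x := rfl

/-- `p/q ↦ p(j)/q(j)`. [folklore] -/
theorem ratFuncAlgHom_div (p q : ℂ[X]) :
    ratFuncAlgHom N (algebraMap ℂ[X] (RatFunc ℂ) p / algebraMap ℂ[X] (RatFunc ℂ) q) =
      aeval (kleinJK N) p / aeval (kleinJK N) q :=
  RatFunc.liftAlgHom_apply_div _ _ p q

/-- `ℂ[X] → ℂ(X) → K_N` is a scalar tower. [folklore] -/
instance isScalarTower_polyJ_ratFunc : IsScalarTower ℂ[X] (RatFunc ℂ) (modularFunctionField N) :=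
  IsScalarTower.of_algebraMap_eq fun p ↦ by
    rw [algebraMap_ratFunc, algebraMap_polyJ]
    have h := ratFuncAlgHom_div (N := N) p 1
    rw [map_one, map_one, div_one, div_one] at h
    exact h.symm

/-- `ℂ → ℂ(X) → K_N` is a scalar tower. [folklore] -/
instance isScalarTower_C_ratFunc : IsScalarTower ℂ (RatFunc ℂ) (modularFunctionField N) :=
  IsScalarTower.of_algebraMap_eq fun c ↦ by rw [algebraMap_ratFunc, AlgHom.commutes]

/-- The image of `ℂ(X)` lies in `ℂ(j)`. [folklore] -/
theorem ratFuncAlgHom_mem (x : RatFunc ℂ) : ratFuncAlgHom N x ∈ ratFuncJ N := by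
  induction x using RatFunc.induction_on with
  | f p q hq =>
    rw [ratFuncAlgHom_div]
    have hle : Algebra.adjoin ℂ {kleinJK N} ≤ (ratFuncJ N).toSubalgebra :=
      IntermediateField.algebra_adjoin_le_adjoin ℂ _
    exact div_mem (hle (Polynomial.aeval_mem_adjoin_singleton ℂ _))
      (hle (Polynomial.aeval_mem_adjoin_singleton ℂ _))

/-- The image of `ℂ(X)` is all of `ℂ(j)`. [folklore] -/
theorem exists_ratFuncAlgHom_eq {y : modularFunctionField N} (hy : y ∈ ratFuncJ N) :
    ∃ x : RatFunc ℂ, ratFuncAlgHom N x = y := by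
  obtain ⟨a, ha, b, hb, rfl⟩ := IntermediateField.mem_adjoin_iff_div.mp hy
  rw [Algebra.adjoin_singleton_eq_range_aeval] at ha hb
  obtain ⟨p, rfl⟩ := ha
  obtain ⟨q, rfl⟩ := hb
  exact ⟨_, ratFuncAlgHom_div p q⟩

/-- `ℂ(X)` acting on `ℂ(j) ⊆ K_N` (a local instance). [folklore] -/
@[reducible] def algebraRatFuncJ (N : ℕ) [NeZero N] : Algebra (RatFunc ℂ) (ratFuncJ N) :=
  ((ratFuncAlgHom N).toRingHom.codRestrict (ratFuncJ N).toSubring (ratFuncAlgHom_mem (N := N))).toAlgebra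

attribute [local instance] algebraRatFuncJ

/-- `ℂ(X) → ℂ(j) → K_N` is a scalar tower. [folklore] -/
instance isScalarTower_ratFuncJ : IsScalarTower (RatFunc ℂ) (ratFuncJ N) (modularFunctionField N) :=
  IsScalarTower.of_algebraMap_eq fun _ ↦ rfl

/-- `ℂ(j)` is a cyclic (so finite) `ℂ(X)`-module. [folklore] -/
theorem finite_ratFuncJ : Module.Finite (RatFunc ℂ) (ratFuncJ N) :=
  Module.Finite.of_surjective (Algebra.linearMap (RatFunc ℂ) (ratFuncJ N)) fun ⟨y, hy⟩ ↦ by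
    obtain ⟨x, hx⟩ := exists_ratFuncAlgHom_eq hy
    exact ⟨x, Subtype.ext hx⟩

/-- **`K_N` is finite over `ℂ(X)`** (through `X ↦ j`; degree `μ`, `finrank_ratFuncJ`). [folklore] -/
instance finite_ratFunc : Module.Finite (RatFunc ℂ) (modularFunctionField N) :=
  haveI := finite_ratFuncJ (N := N)
  Module.Finite.trans (ratFuncJ N) (modularFunctionField N)

/-! ### The integral closure `B` of `ℂ[j]` in `K_N` -/

/-- **The affine ring of `Y₀(N)`**: the integral closure `B` of `ℂ[j]` in `K_N` (Shimura §1.6;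
Diamond–Shurman §7.5). [folklore] -/
abbrev intClosureJ (N : ℕ) [NeZero N] : Subalgebra ℂ[X] (modularFunctionField N) :=
  integralClosure ℂ[X] (modularFunctionField N)

/-- **`B` is a finite `ℂ[j]`-module** (finite separable extension of the fraction field of the
integrally closed Noetherian ring `ℂ[X]`; Stichtenoth Cor. 3.3.5). [folklore] -/
instance finite_intClosureJ : Module.Finite ℂ[X] (intClosureJ N) :=
  IsIntegralClosure.finite ℂ[X] (RatFunc ℂ) (modularFunctionField N) _

/-- **`B` is a Dedekind domain** (integral closure of the Dedekind domain `ℂ[X]` in a finite separable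
extension; Stichtenoth Cor. 3.3.5). [folklore] -/
instance isDedekindDomain_intClosureJ : IsDedekindDomain (intClosureJ N) :=
  integralClosure.isDedekindDomain ℂ[X] (RatFunc ℂ) (modularFunctionField N)

/-- `B` is Noetherian. [folklore] -/
instance isNoetherianRing_intClosureJ : IsNoetherianRing (intClosureJ N) := inferInstance

/-- `v_τ(a(j)) ≤ 1`. [folklore] -/
theorem pointValuation_algebraMap_polyJ_le_one (τ : ℍ) (a : ℂ[X]) :
    pointValuation (N := N) τ (algebraMap ℂ[X] (modularFunctionField N) a) ≤ 1 :=
  (mem_pointPlace_iff τ _).mp (aeval_kleinJK_mem_pointPlace τ a)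

/-! ### `B` is the ring of functions holomorphic on `ℍ` -/

/-- **Integral over `ℂ[j]` ⇒ holomorphic at every point**: the valuation ring `O_{P_τ}` contains
`ℂ[j]` and is integrally closed (the ultrametric inequality). [folklore] -/
theorem mem_pointPlace_of_mem_intClosureJ {x : modularFunctionField N} (hx : x ∈ intClosureJ N)
    (τ : ℍ) : x ∈ (pointPlace (N := N) τ).toValuationSubring := by
  obtain ⟨f, hm, hf⟩ : IsIntegral ℂ[X] x := hx
  rw [mem_pointPlace_iff]
  set v := pointValuation (N := N) τ with hv
  by_contra hlt
  have h1 : 1 < v x := not_le.mp hlt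
  by_cases hn : f.natDegree = 0
  · rw [Polynomial.natDegree_eq_zero] at hn
    obtain ⟨c, rfl⟩ := hn
    have hc : c = 1 := by simpa using hm.leadingCoeff
    rw [hc, map_one, eval₂_one] at hf
    exact one_ne_zero hf
  rw [Polynomial.eval₂_eq_sum_range, Finset.sum_range_succ, hm.coeff_natDegree, map_one, one_mul,
    add_eq_zero_iff_eq_neg] at hf
  have hf' := congrArg v hf
  rw [Valuation.map_neg, Valuation.map_pow] at hf'
  refine absurd hf' (ne_of_lt ?_)
  refine v.map_sum_lt (pow_ne_zero _ (zero_lt_one.trans h1).ne') fun i hi ↦ ?_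
  rw [Finset.mem_range] at hi
  rw [Valuation.map_mul, Valuation.map_pow]
  exact mul_lt_of_le_one_of_lt (pointValuation_algebraMap_polyJ_le_one τ _) (pow_lt_pow_right₀ h1 hi)

/-- **Holomorphic at every point ⇒ integral over `ℂ[j]`** (Krull–Chevalley: if `x ∉ B` there is a
valuation ring `V ⊇ B` of `K_N` with `x ∉ V`, Mathlib's
`Subring.exists_le_valuationSubring_of_isIntegrallyClosedIn`; `V ∋ j` is some `O_{P_τ}` by
`exists_eq_pointPlace`). [folklore] -/
theorem mem_intClosureJ_of_forall_mem {x : modularFunctionField N}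
    (hx : ∀ τ : ℍ, x ∈ (pointPlace (N := N) τ).toValuationSubring) : x ∈ intClosureJ N := by
  by_contra hxB
  obtain ⟨V, hBV, hxV⟩ := Subring.exists_le_valuationSubring_of_isIntegrallyClosedIn
    (R := (intClosureJ N).toSubring) (x := x) hxB
  have hVtop : V ≠ ⊤ := fun h ↦ hxV (h ▸ trivial)
  have hC : ∀ c : ℂ, algebraMap ℂ (modularFunctionField N) c ∈ V := fun c ↦ by
    apply hBV
    rw [IsScalarTower.algebraMap_apply ℂ ℂ[X] (modularFunctionField N)]
    exact (intClosureJ N).algebraMap_mem _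
  let P : PlaceOver ℂ (modularFunctionField N) :=
    { toValuationSubring := V
      ne_top := hVtop
      isDVR := IsAlgFunctionField.isDiscreteValuationRing_of_ne_top_of_algebraMap_mem (K := ℂ) V
        hVtop hC
      algebraMap_mem := hC }
  have hjP : (kleinJK N : modularFunctionField N) ∈ P.toValuationSubring := by
    apply hBV
    rw [← algebraMap_polyJ_X]
    exact (intClosureJ N).algebraMap_mem _
  obtain ⟨τ, hτ⟩ := exists_eq_pointPlace hjP
  exact hxV (show x ∈ P.toValuationSubring from hτ ▸ hx τ)

/-- **`B = {x ∈ K_N | x ∈ O_{P_τ} for all τ ∈ ℍ}`**: the integral closure of `ℂ[j]` in `K_N` is the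
ring of modular functions holomorphic on `ℍ` (Shimura §1.6; Diamond–Shurman §7.5).
[cite: DiamondShurman2005, §7.5] -/
theorem mem_intClosureJ_iff (x : modularFunctionField N) :
    x ∈ intClosureJ N ↔ ∀ τ : ℍ, x ∈ (pointPlace (N := N) τ).toValuationSubring :=
  ⟨mem_pointPlace_of_mem_intClosureJ, mem_intClosureJ_of_forall_mem⟩

/-- `v_τ(b) ≤ 1` for `b ∈ B`. [folklore] -/
theorem pointValuation_le_one_of_mem_intClosureJ {x : modularFunctionField N}
    (hx : x ∈ intClosureJ N) (τ : ℍ) : pointValuation (N := N) τ x ≤ 1 :=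
  (mem_pointPlace_iff τ x).mp (mem_pointPlace_of_mem_intClosureJ hx τ)

/-- **`K_N = Frac B`**, concretely: every `h ∈ K_N` becomes integral over `ℂ[j]` after
multiplication by some `a(j) ≠ 0`. [folklore] -/
theorem exists_polyJ_smul_mem_intClosureJ (x : modularFunctionField N) :
    ∃ a : ℂ[X], a ≠ 0 ∧ a • x ∈ intClosureJ N := by
  obtain ⟨a, ha, h⟩ := exists_integral_multiples ℂ[X] (RatFunc ℂ) {x}
  exact ⟨a, ha, h x (Finset.mem_singleton_self x)⟩

/-- `F/Δ ∈ B`. [folklore] -/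
theorem mkFn_deltaN_mem_intClosureJ (F : ModularForm (Gamma0 N) 12) :
    mkFn F (deltaN N) ofLevelOne_delta_ne_zero ∈ intClosureJ N :=
  mem_intClosureJ_of_forall_mem (mkFn_deltaN_mem_pointPlace F)

/-! ### The maximal ideals of `B` are the points of `Y₀(N)` -/

/-- **The ideal `B ∩ m_{P_τ}` of functions in `B` vanishing at `τ`.** [folklore] -/
def idealAt (τ : ℍ) : Ideal (intClosureJ N) where
  carrier := {b | (b : modularFunctionField N) ∈ (pointPlace (N := N) τ).toValuationSubring.nonunits}
  zero_mem' := by simp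
  add_mem' {a b} ha hb := by
    simp only [Set.mem_setOf_eq, mem_nonunits_pointPlace_iff, Subalgebra.coe_add] at ha hb ⊢
    exact (Valuation.map_add _ _ _).trans_lt (max_lt ha hb)
  smul_mem' c {b} hb := by
    simp only [Set.mem_setOf_eq, mem_nonunits_pointPlace_iff, smul_eq_mul, Subalgebra.coe_mul] at hb ⊢
    rw [Valuation.map_mul]
    calc _ ≤ 1 * pointValuation (N := N) τ b :=
          mul_le_mul' (pointValuation_le_one_of_mem_intClosureJ c.2 τ) le_rfl
      _ < 1 := by rwa [one_mul]

/-- Membership in `idealAt τ` through `v_τ`. [folklore] -/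
theorem mem_idealAt_iff (τ : ℍ) (b : intClosureJ N) :
    b ∈ idealAt (N := N) τ ↔ pointValuation (N := N) τ b < 1 :=
  mem_nonunits_pointPlace_iff τ _

/-- Membership in `idealAt τ` through the place. [folklore] -/
theorem mem_idealAt_iff' (τ : ℍ) (b : intClosureJ N) :
    b ∈ idealAt (N := N) τ ↔
      (b : modularFunctionField N) ∈ (pointPlace (N := N) τ).toValuationSubring.nonunits :=
  Iff.rfl

/-- `idealAt` only depends on the place `P_τ`. [folklore] -/
theorem idealAt_eq_of_pointPlace_eq {τ τ' : ℍ} (h : pointPlace (N := N) τ = pointPlace (N := N) τ') :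
    idealAt (N := N) τ = idealAt (N := N) τ' := by
  ext b; rw [mem_idealAt_iff', mem_idealAt_iff', h]

/-- `idealAt τ` is a prime ideal. [folklore] -/
instance idealAt_isPrime (τ : ℍ) : (idealAt (N := N) τ).IsPrime where
  ne_top' := by
    rw [Ne, Ideal.eq_top_iff_one, mem_idealAt_iff]
    simp
  mem_or_mem' {a b} h := by
    simp only [mem_idealAt_iff, Subalgebra.coe_mul, Valuation.map_mul] at h ⊢
    by_contra hab
    rw [not_or, not_lt, not_lt] at hab
    have h1 : (1 : ℤᵐ⁰) * 1 ≤ _ := mul_le_mul' hab.1 hab.2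
    rw [one_mul] at h1
    exact absurd h (not_lt.mpr h1)

/-- `j − j(τ) ∈ B`. [folklore] -/
theorem kleinJSub_mem_intClosureJ (τ : ℍ) : kleinJSub N τ ∈ intClosureJ N :=
  mkFn_deltaN_mem_intClosureJ _

/-- `idealAt τ ≠ ⊥` (it contains `j − j(τ)`). [folklore] -/
theorem idealAt_ne_bot (τ : ℍ) : idealAt (N := N) τ ≠ ⊥ := by
  intro h
  have hmem : (⟨kleinJSub N τ, kleinJSub_mem_intClosureJ τ⟩ : intClosureJ N) ∈ idealAt (N := N) τ := by
    rw [mem_idealAt_iff, pointValuation_lt_one_iff]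
    exact Or.inr (ordAtN_kleinJSub_pos τ)
  rw [h, Ideal.mem_bot, Subtype.ext_iff, ZeroMemClass.coe_zero] at hmem
  exact kleinJSub_ne_zero τ hmem

/-- `idealAt τ` is a maximal ideal (a nonzero prime of the Dedekind domain `B`). [folklore] -/
instance idealAt_isMaximal (τ : ℍ) : (idealAt (N := N) τ).IsMaximal :=
  (idealAt_isPrime τ).isMaximal (idealAt_ne_bot τ)

/-- **Every nonzero prime ideal of `B` is `B ∩ m_{P_τ}` for some `τ ∈ ℍ`**: the maximal spectrum of
the affine ring `B` is `Y₀(N)` (Chevalley's extension theorem gives a valuation ring `V ⊇ B` whose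
maximal ideal contracts to the prime; `V ∋ j` is an `O_{P_τ}`; Shimura §1.6, Diamond–Shurman §7.5).
[cite: DiamondShurman2005, §7.5] -/
theorem exists_le_idealAt (Q : Ideal (intClosureJ N)) (hQ : Q ≠ ⊤) :
    ∃ τ : ℍ, Q ≤ idealAt (N := N) τ ∨
      ∀ b ∈ Q, (b : modularFunctionField N) = 0 := by
  -- transport `Q` to an ideal of the subring `B.toSubring`
  let e : (intClosureJ N).toSubring →+* intClosureJ N :=
    { toFun := fun x ↦ ⟨x.1, x.2⟩
      map_one' := rfl
      map_mul' := fun _ _ ↦ rfl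
      map_zero' := rfl
      map_add' := fun _ _ ↦ rfl }
  set Q' : Ideal (intClosureJ N).toSubring := Q.comap e with hQ'
  have hQ'top : Q' ≠ ⊤ := by
    rw [Ne, Ideal.eq_top_iff_one, hQ', Ideal.mem_comap, map_one, ← Ideal.eq_top_iff_one]
    exact hQ
  obtain ⟨V, hBV, hQV⟩ := Ideal.image_subset_nonunits_valuationSubring Q' hQ'top
  have hmemQ : ∀ b ∈ Q, (b : modularFunctionField N) ∈ V.nonunits := fun b hb ↦
    hQV ⟨⟨b.1, b.2⟩, by change e ⟨b.1, b.2⟩ ∈ Q; exact hb, rfl⟩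
  by_cases hVtop : V = ⊤
  · refine ⟨UpperHalfPlane.I, Or.inr fun b hb ↦ ?_⟩
    have h := hmemQ b hb
    rw [ValuationSubring.mem_nonunits_iff_or] at h
    rcases h with h | h
    · exact h
    · exact absurd (hVtop ▸ trivial : (b : modularFunctionField N)⁻¹ ∈ V) h
  have hC : ∀ c : ℂ, algebraMap ℂ (modularFunctionField N) c ∈ V := fun c ↦ by
    apply hBV
    rw [IsScalarTower.algebraMap_apply ℂ ℂ[X] (modularFunctionField N)]
    exact (intClosureJ N).algebraMap_mem _
  let P : PlaceOver ℂ (modularFunctionField N) :=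
    { toValuationSubring := V
      ne_top := hVtop
      isDVR := IsAlgFunctionField.isDiscreteValuationRing_of_ne_top_of_algebraMap_mem (K := ℂ) V
        hVtop hC
      algebraMap_mem := hC }
  have hjP : (kleinJK N : modularFunctionField N) ∈ P.toValuationSubring := by
    apply hBV
    rw [← algebraMap_polyJ_X]
    exact (intClosureJ N).algebraMap_mem _
  obtain ⟨τ, hτ⟩ := exists_eq_pointPlace hjP
  have hV : V = (pointPlace (N := N) τ).toValuationSubring := congrArg PlaceOver.toValuationSubring hτ
  refine ⟨τ, Or.inl fun b hb ↦ ?_⟩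
  rw [mem_idealAt_iff', ← hV]
  exact hmemQ b hb

/-- **Every nonzero prime ideal of `B` is `idealAt τ` for some `τ ∈ ℍ`.** [cite: DiamondShurman2005, §7.5] -/
theorem exists_eq_idealAt (Q : Ideal (intClosureJ N)) [hQp : Q.IsPrime] (hQ : Q ≠ ⊥) :
    ∃ τ : ℍ, Q = idealAt (N := N) τ := by
  obtain ⟨τ, h | h⟩ := exists_le_idealAt Q hQp.ne_top
  · exact ⟨τ, (hQp.isMaximal hQ).eq_of_le (idealAt_isPrime τ).ne_top h⟩
  · exfalso; apply hQ
    rw [eq_bot_iff]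
    intro b hb
    rw [Ideal.mem_bot]
    exact Subtype.ext (h b hb)

end Literature.NumberTheory.EllipticCurves.ModularForms

end
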